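import Mathlib
import Summits.Ventures.HodgeRepro2.T6Interface

/-!
# T6N — the displayed hypothesis (N) of Theorem A, literally

The ONE displayed hypothesis of the M1 theorem (README §10.4), stated as a `Prop` exactly as the record
states it (TIER4 A3 Theorem A(ii); TIER5 (N0.2)):

«(N) there exist σ ∈ Σ and an admissible choice of (K, (μ_i, ε_i, χ_i)_i, (q_i)_i, (p_i)_i) in (N0.1)(b)
such that ∫_S f_1^*e_{1,σ} ∧ f_2^*e_{2,σ} ∧ f_3^*e_{3,σ} ∧ f_4^*e_{4,σ} ≠ 0.»  (TIER5.md §N0 (N0.2), l. 57)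

In the interface's terms the «admissible choice» is the datum `D : TransferShadow F` (its surface shadow
`HS`, `pull = f^*`, `intS = ∫_S`), `Σ = Hom(K, ℂ)` is `K →+* ℂ`, `e_{i,σ}` is any generator of the eigenline
`ℓ_{i,σ}` (`eigenLine K i σ`; a non-zero rescaling multiplies the period by a non-zero scalar, TIER4 A3
Lemma A7.3(a), so the display quantifies over the generators), and `f_1^*e_{1,σ} ∧ … ∧ f_4^*e_{4,σ} =
f^*(e_{1,σ} ∧ … ∧ e_{4,σ})` because `f^*` is a ring homomorphism (`pull`). The internal form
`PeriodInputN D` (∃ w ∈ W_ℂ, ∫_S f^* w ≠ 0) follows (`periodInputN_of_hyp`); the converse is a support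
lemma of A3 (t6-p3). §8(d): uses an L-value-free non-vanishing device: NO.
-/

namespace Summit.Ventures.HodgeRepro2.T6

variable {K : Type*} [Field K] [NumberField K]

namespace Hyp

/-- [display: TIER4 A3 Theorem A(ii) hypothesis (N); TIER5 §N0 (N0.2) l. 57 — «there exist σ ∈ Σ and an admissible
choice … such that ∫_S f_1^*e_{1,σ} ∧ f_2^*e_{2,σ} ∧ f_3^*e_{3,σ} ∧ f_4^*e_{4,σ} ≠ 0»]
The period input (N), for the datum `D`: some embedding `σ : K →+* ℂ` and generators `e i ∈ ℓ_{i,σ}` have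
`∫_S f^*(e 0 ∧ e 1 ∧ e 2 ∧ e 3) ≠ 0`. (The `e i` are forced non-zero by the conclusion.) -/
def PeriodN {F : FaceSetting K} (D : TransferShadow F) : Prop :=
  ∃ σ : K →+* ℂ, ∃ e : Fin 4 → H1C K, (∀ i, e i ∈ eigenLine K i σ) ∧
    D.intS (D.pull (ExteriorAlgebra.ι ℂ (e 0) * ExteriorAlgebra.ι ℂ (e 1) *
      ExteriorAlgebra.ι ℂ (e 2) * ExteriorAlgebra.ι ℂ (e 3))) ≠ 0

end Hyp

/-- `ι v ∈ ιW W` for `v ∈ W`. -/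
theorem ι_mem_ιW {W : Submodule ℂ (H1C K)} {v : H1C K} (hv : v ∈ W) :
    ExteriorAlgebra.ι ℂ v ∈ ιW W :=
  Submodule.mem_map_of_mem hv

/-- The displayed (N) gives the internal period input: `w := e_{1,σ} ∧ e_{2,σ} ∧ e_{3,σ} ∧ e_{4,σ} ∈ W_ℂ`. -/
theorem periodInputN_of_hyp {F : FaceSetting K} {D : TransferShadow F} (h : Hyp.PeriodN D) :
    PeriodInputN D := by
  obtain ⟨σ, e, he, hne⟩ := h
  refine ⟨_, ?_, hne⟩
  unfold weilC
  refine Submodule.mem_iSup_of_mem σ ?_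
  refine Submodule.mul_mem_mul (Submodule.mul_mem_mul (Submodule.mul_mem_mul ?_ ?_) ?_) ?_ <;>
    exact ι_mem_ιW (he _)

end Summit.Ventures.HodgeRepro2.T6
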